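import Mathlib
import HarnessLib
import Literature.Analysis.ODE.FlowWithin
import Literature.Analysis.FluidPDE.Tao2016AveragedNS.TaylorChainCertificate
import Summits.NavierStokesRegularity.NavierStokesRegularity.Theorems.TaylorModelRungThreeReadoutFlowVar
import Summits.NavierStokesRegularity.NavierStokesRegularity.Theorems.TaylorModelRungThreeReadoutG3Base
import Summits.NavierStokesRegularity.NavierStokesRegularity.Theorems.TaylorModelRungThreeReadoutG3Flow
import Summits.NavierStokesRegularity.NavierStokesRegularity.Theorems.TaylorModelRungThreeReadoutG4Clauses
import Summits.NavierStokesRegularity.NavierStokesRegularity.Theorems.TaylorModelRungThreeReadoutG4Norm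
import Summits.NavierStokesRegularity.NavierStokesRegularity.Theorems.TaylorModelRungThreeReadoutG4Flow

/-!
# Line `taylor-model` on crux K1b-DR (stmt-NavierStokesRegularity-23954) — stub G4 (`LandingC1`),
# helper 4: the window flow of a package as a `Literature.Analysis.ODE.IsSolutionFamily`; derivatives of
# frozen-time flow maps along the entry segment EXIST (variational equation)

Toward the registered stub `stub_landing : LandingC1` (skeleton v4.1/v4.2, statement
`…Theorems.TaylorModel.LandingC1`, hypothesis `IsWindowFlow cd φ`; the v4.1 interface yields the v4 interface
`IsFlowPackage` by engine-1's landed `isFlowPackage_of_isWindowFlow`, module `…ReadoutWindowBridge`, so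
everything below is stated over `IsFlowPackage` and this file stays route-independent). Contents:

* the entry SEGMENT `seg cd j q σ = x j 0 + σ • (q − x j 0)` stays in the (convex) entry polytope;
* `wflow cd φ j x t := toVec (stAt φ j (ofVec x) t)` — the package flow in window coordinates — is an
  `IsSolutionFamily (fW cd) univ A T` on every set `A` of window data solved on `[0, T]`
  (`isSolutionFamily_wflow`), hence, the field being `C¹`, every frozen-time map `x ↦ wflow x τ` is
  Fréchet-differentiable within `A` (`exists_hasFDerivWithinAt_wflow`, from
  `IsSolutionFamily.exists_linearization` + `IsSolutionFamily.hasFDerivWithinAt`, Lang IV §1 Thm 1.14);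
* consequently the σ-derivative of `σ ↦ toVec (stAt φ j (seg σ) t)` within `[0, 1]` EXISTS at every
  `σ ∈ [0,1]` and every `t ∈ [0, Tn S]` (`exists_segDeriv`) — no hand-rolled chain rule through the nodes.

MODEL-lattice bookkeeping only (rung TL-M3); nothing here is a statement about the Navier–Stokes equations.
-/

noncomputable section

-- the sub-problem namespace repeats the summit name by design (D-0017)
set_option linter.dupNamespace false

namespace Summit.NavierStokesRegularity.NavierStokesRegularity.Theorems.TaylorModelReadout.G4

open scoped BigOperators Topology
open Set Literature.Analysis.FluidPDE.TaoCascade Literature.Analysis.FluidPDE.TaoCascade.TaylorChain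
variable {cd : CertData} {φ : Flow} {j : ℕ}

/-! ### The entry segment -/

variable (cd j) in
/-- The entry segment `x j 0 + σ (q − x j 0)` of K1b-DR's landing clause. [folklore] -/
def seg (q : Fin 4 → ℤ → ℝ) (σ : ℝ) : Fin 4 → ℤ → ℝ := cd.x j 0 + σ • (q - cd.x j 0)

/-- The entry polytope is convex: the segment from the base point to a polytope point stays in it. [folklore] -/
theorem inPoly_seg {q : Fin 4 → ℤ → ℝ} (hx : InPoly cd j (cd.x j 0)) (hq : InPoly cd j q) {σ : ℝ}
    (hσ : σ ∈ Icc (0:ℝ) 1) : InPoly cd j (seg cd j q σ) := by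
  intro l
  have h1 := hx l
  have h2 := hq l
  have e : cd.ℓ j l (seg cd j q σ) - cd.ctr j l =
      (1 - σ) * (cd.ℓ j l (cd.x j 0) - cd.ctr j l) + σ * (cd.ℓ j l q - cd.ctr j l) := by
    simp only [seg, map_add, map_smul, map_sub, smul_eq_mul]; ring
  rw [e]
  calc |(1 - σ) * (cd.ℓ j l (cd.x j 0) - cd.ctr j l) + σ * (cd.ℓ j l q - cd.ctr j l)|
      ≤ |(1 - σ) * (cd.ℓ j l (cd.x j 0) - cd.ctr j l)| + |σ * (cd.ℓ j l q - cd.ctr j l)| := abs_add_le _ _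
    _ = (1 - σ) * |cd.ℓ j l (cd.x j 0) - cd.ctr j l| + σ * |cd.ℓ j l q - cd.ctr j l| := by
        rw [abs_mul, abs_mul, abs_of_nonneg (by linarith [hσ.2]), abs_of_nonneg hσ.1]
    _ ≤ (1 - σ) * cd.rad j l + σ * cd.rad j l :=
        add_le_add (mul_le_mul_of_nonneg_left h1 (by linarith [hσ.2])) (mul_le_mul_of_nonneg_left h2 hσ.1)
    _ = cd.rad j l := by ring

/-- The segment in window coordinates is affine in `σ`. [folklore] -/
theorem toVec_seg (q : Fin 4 → ℤ → ℝ) (σ : ℝ) :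
    toVec cd (seg cd j q σ) = toVec cd (cd.x j 0) + σ • toVec cd (q - cd.x j 0) := by
  simp [seg]

/-- The σ-derivative of the segment in window coordinates. [folklore] -/
theorem hasDerivWithinAt_toVec_seg (q : Fin 4 → ℤ → ℝ) (s : Set ℝ) (σ : ℝ) :
    HasDerivWithinAt (fun σ' => toVec cd (seg cd j q σ')) (toVec cd (q - cd.x j 0)) s σ := by
  have h : HasDerivWithinAt (fun σ' : ℝ => toVec cd (cd.x j 0) + σ' • toVec cd (q - cd.x j 0))
      ((1:ℝ) • toVec cd (q - cd.x j 0)) s σ :=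
    ((hasDerivWithinAt_id σ s).smul_const _).const_add _
  rw [one_smul] at h
  exact h.congr (fun σ' _ => toVec_seg q σ') (toVec_seg q σ)

/-! ### The window flow of a package is a solution family -/

variable (cd φ j) in
/-- The package flow read in window coordinates, indexed by window data. [folklore] -/
def wflow (x : Fin (nW cd) → ℝ) (t : ℝ) : Fin (nW cd) → ℝ := toVec cd (stAt φ j (ofVec cd x) t)

section Pack

variable (hF : IsFlowPackage cd φ) (hj : j ≤ cd.N₀)
include hF hj

/-- The zero extension of the window coordinates of a solved datum is solved (window congruence). [folklore] -/
theorem solvesOn_ofVec_toVec {z : Fin 4 → ℤ → ℝ} {T : ℝ} (hz : SolvesOn cd φ j z T) (hT : 0 ≤ T) :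
    SolvesOn cd φ j (ofVec cd (toVec cd z)) T :=
  solvesOn_congr hF hj hz hT fun i k hk1 hk2 => by
    rw [ofVec_toVec, trunc_apply, if_pos ⟨hk1, hk2⟩]

/-- On a solved datum the window flow is the trajectory read in window coordinates. [folklore] -/
theorem wflow_toVec {z : Fin 4 → ℤ → ℝ} {T : ℝ} (hz : SolvesOn cd φ j z T) (hT : 0 ≤ T) {t : ℝ}
    (ht : t ∈ Icc 0 T) : wflow cd φ j (toVec cd z) t = toVec cd (stAt φ j z t) := by
  rw [wflow, stAt_congr_of_solvesOn hF hj hz hT (fun i k hk1 hk2 => by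
    rw [ofVec_toVec, trunc_apply, if_pos ⟨hk1, hk2⟩]) ht]

omit hF hj in
/-- **The window flow is a solution family** of `u' = fW u` on `[0, T]`, on every set of window data whose
zero extensions are solved on `[0, T]`. [folklore] -/
theorem isSolutionFamily_wflow {A : Set (Fin (nW cd) → ℝ)} {T : ℝ}
    (hA : ∀ x ∈ A, SolvesOn cd φ j (ofVec cd x) T) :
    Literature.Analysis.ODE.IsSolutionFamily (fW cd) univ A T (wflow cd φ j) where
  init x hx := by rw [wflow, toVec_stAt_zero (hA x hx), toVec_ofVec]
  hasDerivWithinAt x hx τ hτ := hasDerivWithinAt_toVec_stAt (hA x hx) hτ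
  mem _ _ _ _ := mem_univ _

omit hF hj in
/-- **Frozen-time flow maps are differentiable within the family** (variational equation): one derivative
map `J x τ` for all `x ∈ A`, `τ ∈ [0, T]`. [folklore] -/
theorem exists_hasFDerivWithinAt_wflow {A : Set (Fin (nW cd) → ℝ)} {T : ℝ} (hT : 0 ≤ T)
    (hA : ∀ x ∈ A, SolvesOn cd φ j (ofVec cd x) T) :
    ∃ J : (Fin (nW cd) → ℝ) → ℝ → (Fin (nW cd) → ℝ) →L[ℝ] (Fin (nW cd) → ℝ),
      ∀ x ∈ A, ∀ τ ∈ Icc 0 T, HasFDerivWithinAt (fun x' => wflow cd φ j x' τ) (J x τ) A x := by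
  have hfam := isSolutionFamily_wflow hA
  have hf1 : ContDiffOn ℝ 1 (fW cd) univ := (contDiff_fW cd (n := 1)).contDiffOn
  obtain ⟨J, hJ0, hJ⟩ := hfam.exists_linearization hT uniqueDiffOn_univ hf1
  exact ⟨J, fun x hx τ hτ => hfam.hasFDerivWithinAt hT convex_univ uniqueDiffOn_univ hf1 hx (hJ0 x hx) (hJ x hx) hτ⟩

omit hF hj in
/-- Frozen-time flow maps are continuous within the family. [folklore] -/
theorem continuousWithinAt_wflow {A : Set (Fin (nW cd) → ℝ)} {T : ℝ} (hT : 0 ≤ T)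
    (hA : ∀ x ∈ A, SolvesOn cd φ j (ofVec cd x) T) {x : Fin (nW cd) → ℝ} (hx : x ∈ A) {τ : ℝ}
    (hτ : τ ∈ Icc 0 T) : ContinuousWithinAt (fun x' => wflow cd φ j x' τ) A x := by
  obtain ⟨J, hJ⟩ := exists_hasFDerivWithinAt_wflow hT hA
  exact (hJ x hx τ hτ).continuousWithinAt

/-! ### Derivatives along the entry segment -/

/-- **σ-derivatives of frozen-time flow maps along the entry segment exist** on the whole stage: for
`q` in the polytope there is `D σ t` with
`HasDerivWithinAt (σ' ↦ toVec (stAt φ j (seg σ') t)) (D σ t) [0,1] σ` for all `σ ∈ [0,1]`, `t ∈ [0, Tn S]`.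
[folklore] -/
theorem exists_segDeriv (hC : ChainEnclosure cd φ) (hV : cd.Valid) {q : Fin 4 → ℤ → ℝ} (hq : InPoly cd j q) :
    ∃ D : ℝ → ℝ → (Fin (nW cd) → ℝ), ∀ σ ∈ Icc (0:ℝ) 1, ∀ t ∈ Icc 0 (cd.Tn j (cd.S j)),
      HasDerivWithinAt (fun σ' => toVec cd (stAt φ j (seg cd j q σ') t)) (D σ t) (Icc 0 1) σ := by
  set T := cd.Tn j (cd.S j) with hTdef
  have hT : 0 ≤ T := G3.Tn_nonneg hV hj le_rfl
  set A : Set (Fin (nW cd) → ℝ) := (fun σ => toVec cd (seg cd j q σ)) '' Icc 0 1 with hAdef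
  have hsol : ∀ σ ∈ Icc (0:ℝ) 1, SolvesOn cd φ j (seg cd j q σ) T := fun σ hσ =>
    (hC j hj (seg cd j q σ) (inPoly_seg (inPoly_x0 hV hj) hq hσ)).1
  have hA : ∀ x ∈ A, SolvesOn cd φ j (ofVec cd x) T := by
    rintro _ ⟨σ, hσ, rfl⟩
    exact solvesOn_ofVec_toVec hF hj (hsol σ hσ) hT
  obtain ⟨J, hJ⟩ := exists_hasFDerivWithinAt_wflow hT hA
  refine ⟨fun σ t => J (toVec cd (seg cd j q σ)) t (toVec cd (q - cd.x j 0)), fun σ hσ t ht => ?_⟩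
  have hx : toVec cd (seg cd j q σ) ∈ A := ⟨σ, hσ, rfl⟩
  have hmaps : MapsTo (fun σ' => toVec cd (seg cd j q σ')) (Icc (0:ℝ) 1) A := fun σ' hσ' => ⟨σ', hσ', rfl⟩
  have hcomp := (hJ _ hx t ht).comp_hasDerivWithinAt σ (hasDerivWithinAt_toVec_seg q (Icc 0 1) σ) hmaps
  refine hcomp.congr_of_mem (fun σ' hσ' => ?_) hσ
  simp only [Function.comp_apply]
  rw [wflow_toVec hF hj (hsol σ' hσ') hT ht]

end Pack

end Summit.NavierStokesRegularity.NavierStokesRegularity.Theorems.TaylorModelReadout.G4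

end
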